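import Summits.QuantumAdvantage.QuantumAdvantage.Theorems.CubicForrelationNearExactIsExactCubicFormR4Final
import Summits.QuantumAdvantage.QuantumAdvantage.Theorems.CubicForrelationNearExactIsExactCubicFormR2LowAssembly

/-!
# Crux `CubicForrelation.NearExactIsExact` (stmt-QuantumAdvantage-14043) — n = 12: `θ₁₂ = 57/64` (the sharp near-exact constant on 12 bits)

Certificate seat `b2b-cforr-cert` (gen 43).  HONEST FRAMING: a kernel-checked CERTIFICATE RUNG (standard axioms): the least `θ` such that
every pair of cubic Boolean functions on `12` bits with forrelation `> θ` has forrelation exactly `1` is `57/64`.  It is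
`theta_twelve_eq_57_64_of_R4` (…CubicFormR2LowAssembly, cert seat g42: the digit ladder, the R2 half and the conditional packaging)
applied to `tpw_HR4` (…CubicFormR4Final).  A value of the n = 12 slice only — it says nothing about the summit statement
`NearExactIsExact` (all even `n`, one `θ < 1`); NOT summit progress.

References: this seat lineage (g20–g43; E1280-HANDPROOFS, R2-PARTNER.md, R4-PARTNER.md).  Axioms: the standard three.
-/

set_option linter.dupNamespace false -- D-0017: single-problem summit ⇒ `QuantumAdvantage.QuantumAdvantage` by design

namespace Summit.QuantumAdvantage.QuantumAdvantage.Theorems.CubicForrelation.NearExactIsExact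

open Literature.Computability.QuantumComplexity

/-- **`θ₁₂ = 57/64`.**  See the module docstring. [this work] -/
theorem theta_twelve_eq_57_64 :
    IsLeast {θ : ℝ | ∀ f g : (Fin 12 → Bool) → Bool, IsDegLeFun 3 f → IsDegLeFun 3 g →
      θ < forrelation f g → forrelation f g = 1} (57 / 64) :=
  theta_twelve_eq_57_64_of_R4 tpw_HR4

end Summit.QuantumAdvantage.QuantumAdvantage.Theorems.CubicForrelation.NearExactIsExact
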